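import Summits.HodgeConjecture.HodgeConjecture.Theorems.PadicSemiregularLiftHodgeFermatVarietiesGeneralTwinGlue

/-!
# GP without the twin exclusion, VI-a — the twin configuration of the level analysis (`PairedNull.fibre_of_top_level_general₂_key`)

Part 6a of 9 (Sketch ll. 1191–1353, the local `hkey` of `fibre_of_top_level_general₂`, promoted to a lemma): `p₁ (p₁+2) ∣ M` and `#supp T = R` ⟹
`M = p₁ (p₁+2) n''` with `p₁ + 2` prime, and `GenTwin.even_or_fibre_twin_any` + `GenTwin.false_of_row` give a full `p₁`-fibre.

PROVENANCE. Cell hodge-nonav planner p1 g33 (memo ROUTE-P1AF-ADD5 ffaf9911041dfeba; referee PASS ref g53 REF-P1AF-ADD5.md bcccb0bceb665800), frozen Sketch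
`HOME/p1/route/Sketch_P1AF_RGENTWIN_g33.lean` (596f05bb769cab0c) Part 2, TREE namespace `…CancelByAnyClaimLattice.PairedNull`; the `[ADD5]` twin branch of
`fibre_of_top_level_general₂` extracted into `…FibreOfTopLevelGeneralTwinKey` by planner p1 g34 (landing kit HOME/p1/landing/, size cap) — proof text otherwise
verbatim. Land with `--supports stmt-HodgeConjecture-1334`. No instance, no notation, no sorry, no new axiom. HONEST SCOPE: combinatorics of Hodge multisets of
`ℤ/m` (Fermat `(p₁−1)`-folds, AV-dominated region); NOTHING here proves the Hodge conjecture. Method after N. Aoki, Math. Ann. 266 (1983) §§6–9 [cite: Aoki1983, Thm. A].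
-/

set_option linter.dupNamespace false

noncomputable section

open Finset
open Literature.AlgebraicGeometry.HodgeTheory Literature.AlgebraicGeometry.HodgeTheory.FermatCharacter
open Summit.HodgeConjecture.HodgeConjecture.Theorems.CancelByAnyClaimLattice
open Summit.HodgeConjecture.HodgeConjecture.Theorems.CancelByAnyClaimLattice.PairedNull

namespace Summit.HodgeConjecture.HodgeConjecture.Theorems.CancelByAnyClaimLattice

namespace PairedNull

section TopLevelGeneralTwinKey

variable {m : ℕ} [NeZero m] {R : ℕ} {α : Fin R → ZMod m}


/-- **The twin configuration of the level analysis** (the `[ADD5]` branch of `fibre_of_top_level_general₂`, extracted so that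
each file stays under the tree's size cap): if `p₁ (p₁+2) ∣ M` and the multiplicity function `T` of the level-`M` unit parts of `α` has
full support `#supp T = R = p₁ + 1`, then `p₁ + 2` is prime, `M = p₁ (p₁+2) n''`, and the two-prime local lemma
(`GenTwin.even_or_fibre_twin_any`) leaves either a ROW (all unit parts `≡ u₀ (mod p₁)`, killed by `GenTwin.false_of_row`) or a
COLUMN — a full `p₁`-fibre, the conclusion. `cnt`/`T` enter as variables with their defining equations so that the caller's
`set … with` context applies verbatim; `NeZero M` is taken as an instance (the caller has it from `M ∣ m`). (statement: line `cancel-by-any-claim-lattice` ∕ cell hodge-nonav P1 g33–g34; not in print;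
method after Aoki 1983 §§6–9) -/
theorem fibre_of_top_level_general₂_key {p₁ : ℕ} (hp₁ : p₁.Prime) (hp₁5 : 5 ≤ p₁) (hp₁11 : 11 ≤ p₁) (hRp : R = p₁ + 1)
    (hmin : ∀ q ∈ m.primeFactors, p₁ ≤ q) (hsq : ¬ p₁ * p₁ ∣ m) (hsq₂ : ¬ (p₁ + 2) * (p₁ + 2) ∣ m) (h : IsHodge α)
    {M : ℕ} [NeZero M] (hMm : M ∣ m)
    (cnt : ZMod M → ℕ)
    (hcnt : cnt = fun u ↦
      #(univ.filter fun i : Fin R ↦ m / m.gcd (α i).val = M ∧ ((((α i).val / (m / M)) : ℕ) : ZMod M) = u))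
    (T : ZMod M → ℂ) (hT : T = fun u ↦ (cnt u : ℂ))
    (hTu : ∀ u, ¬ IsUnit u → T u = 0)
    (hTodd : ∀ χ : DirichletCharacter ℂ M, χ.Odd → χ.IsPrimitive → ∑ u : ZMod M, T u * χ u = 0)
    (hnotev : ¬ ∀ u, T (-u) = T u)
    (hp₁M : p₁ ∣ M) (hp₀M : (p₁ + 2) ∣ M) (hSR : #(univ.filter fun u : ZMod M ↦ T u ≠ 0) = R) :
    ∃ (n : ℕ) (hc : Nat.Coprime p₁ n), M = p₁ * n ∧ 1 < n ∧ ∃ b : ZMod n, IsUnit b ∧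
      ∀ y : (ZMod p₁)ˣ, ∃ i : Fin R, m / m.gcd (α i).val = p₁ * n ∧
        ((((α i).val / (m / (p₁ * n))) : ℕ) : ZMod (p₁ * n)) = (ZMod.chineseRemainder hc).symm ((y : ZMod p₁), b) := by
  classical
  haveI : NeZero p₁ := ⟨hp₁.ne_zero⟩
  have hm0 : m ≠ 0 := NeZero.ne m
  have hM0 : M ≠ 0 := NeZero.ne M
  have hp₁2 : p₁ ≠ 2 := by omega
  have hp₁odd : Odd p₁ := hp₁.odd_of_ne_two hp₁2
  set I : Finset (Fin R) := univ.filter fun i : Fin R ↦ m / m.gcd (α i).val = M with hI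
  have hsupp_img : (univ.filter fun u : ZMod M ↦ T u ≠ 0) =
      I.image fun i ↦ ((((α i).val / (m / M)) : ℕ) : ZMod M) := by
    ext u
    rw [mem_filter, mem_image]
    simp only [mem_univ, true_and, hT, Nat.cast_ne_zero, hcnt]
    rw [Finset.card_ne_zero]
    constructor
    · rintro ⟨i, hi⟩
      rw [mem_filter] at hi
      exact ⟨i, by rw [hI, mem_filter]; exact ⟨mem_univ _, hi.2.1⟩, hi.2.2⟩
    · rintro ⟨i, hi, hiu⟩
      rw [hI, mem_filter] at hi
      exact ⟨i, by rw [mem_filter]; exact ⟨mem_univ _, hi.2, hiu⟩⟩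
  -- every prime of `m` (hence of `M`) is at least `p₁ ≥ 5`
  have hMmin : ∀ p ∈ M.primeFactors, p₁ ≤ p := fun p hp ↦ hmin p (Nat.mem_primeFactors.mpr
    ⟨Nat.prime_of_mem_primeFactors hp, (Nat.dvd_of_mem_primeFactors hp).trans hMm, hm0⟩)
  have hM5 : ∀ p ∈ M.primeFactors, 5 ≤ p := fun p hp ↦ hp₁5.trans (hMmin p hp)
  -- sum of the multiplicities over the support is at most `R`
  have hsum_cnt : ∑ u ∈ univ.filter (fun u : ZMod M ↦ T u ≠ 0), cnt u ≤ R := by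
    have hfib : ∑ u : ZMod M, cnt u = #I := by
      rw [hI, Finset.card_eq_sum_ones, ← Finset.sum_fiberwise_of_maps_to (t := univ)
        (g := fun i : Fin R ↦ ((((α i).val / (m / M)) : ℕ) : ZMod M)) (fun i _ ↦ mem_univ _)]
      refine Finset.sum_congr rfl fun u _ ↦ ?_
      rw [hcnt, Finset.sum_const, smul_eq_mul, mul_one, Finset.filter_filter]
    calc ∑ u ∈ univ.filter (fun u : ZMod M ↦ T u ≠ 0), cnt u ≤ ∑ u : ZMod M, cnt u :=
          Finset.sum_le_sum_of_subset (filter_subset _ _)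
      _ = #I := hfib
      _ ≤ R := (card_le_univ I).trans (by rw [Fintype.card_fin])
  have hge1 : ∀ u ∈ univ.filter (fun u : ZMod M ↦ T u ≠ 0), 1 ≤ cnt u := by
    intro u hu
    rw [mem_filter] at hu
    have : cnt u ≠ 0 := fun h0 ↦ hu.2 (by simp only [hT, h0, Nat.cast_zero])
    omega
  -- `T` takes only the values `0, 1` (verbatim from the twin branch)
  have h01 : ∀ u, T u = 0 ∨ T u = 1 := by
    have hones : ∑ u ∈ univ.filter (fun u : ZMod M ↦ T u ≠ 0), (1 : ℕ) = R := by
      rw [Finset.sum_const, smul_eq_mul, mul_one, hSR]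
    have heq : ∀ u ∈ univ.filter (fun u : ZMod M ↦ T u ≠ 0), cnt u = 1 := by
      have hle2 : ∑ u ∈ univ.filter (fun u : ZMod M ↦ T u ≠ 0), cnt u ≤
          ∑ u ∈ univ.filter (fun u : ZMod M ↦ T u ≠ 0), (1 : ℕ) := by rw [hones]; exact hsum_cnt
      have := (Finset.sum_eq_sum_iff_of_le hge1).mp (le_antisymm (Finset.sum_le_sum hge1) hle2)
      exact fun u hu ↦ (this u hu).symm
    intro u
    by_cases hu : T u = 0
    · exact Or.inl hu
    · right
      have h1 := heq u (by rw [mem_filter]; exact ⟨mem_univ _, hu⟩)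
      simp only [hT, h1, Nat.cast_one]
  -- every index has level `M` and its unit part lies in the support
  have hIcard : #I = R := by
    refine le_antisymm ((card_le_univ I).trans (by rw [Fintype.card_fin])) ?_
    calc R = #(univ.filter fun u : ZMod M ↦ T u ≠ 0) := hSR.symm
      _ = #(I.image fun i ↦ ((((α i).val / (m / M)) : ℕ) : ZMod M)) := by rw [hsupp_img]
      _ ≤ #I := card_image_le
  have hIuniv : I = univ := Finset.eq_univ_of_card I (by rw [hIcard, Fintype.card_fin])
  have hres : ∀ i : Fin R, m / m.gcd (α i).val = M ∧
      ((((α i).val / (m / M)) : ℕ) : ZMod M) ∈ univ.filter fun u : ZMod M ↦ T u ≠ 0 := by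
    intro i
    have hiI : i ∈ I := hIuniv ▸ mem_univ i
    refine ⟨(mem_filter.mp hiI).2, ?_⟩
    rw [hsupp_img]
    exact mem_image_of_mem _ hiI
  obtain ⟨n, rfl⟩ := hp₁M
  have hn0 : n ≠ 0 := fun h0 ↦ hM0 (by rw [h0, mul_zero])
  haveI : NeZero n := ⟨hn0⟩
  have hpn : ¬ p₁ ∣ n := fun hd ↦ hsq ((mul_dvd_mul_left p₁ hd).trans hMm)
  have hc : Nat.Coprime p₁ n := (Nat.Prime.coprime_iff_not_dvd hp₁).mpr hpn
  -- `p₀ = p₁ + 2` divides `n` and is prime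
  have hcop2 : Nat.Coprime (p₁ + 2) p₁ := by
    rw [Nat.coprime_comm, Nat.coprime_self_add_right]
    exact (Nat.coprime_primes hp₁ Nat.prime_two).mpr hp₁2
  have hp₀n : p₁ + 2 ∣ n := hcop2.dvd_of_dvd_mul_left hp₀M
  have hp₀ : (p₁ + 2).Prime := by
    have hq := Nat.minFac_prime (show p₁ + 2 ≠ 1 by omega)
    have hqd : (p₁ + 2).minFac ∣ p₁ + 2 := Nat.minFac_dvd _
    have hqM : (p₁ + 2).minFac ∈ (p₁ * n).primeFactors :=
      Nat.mem_primeFactors.mpr ⟨hq, hqd.trans hp₀M, hM0⟩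
    have hge := hMmin _ hqM
    have hle : (p₁ + 2).minFac ≤ p₁ + 2 := Nat.minFac_le (by omega)
    have hne0 : (p₁ + 2).minFac ≠ p₁ := fun he ↦ hpn (he ▸ (hqd.trans hp₀n))
    have hne1 : (p₁ + 2).minFac ≠ p₁ + 1 := by
      intro he
      have h2 : 2 ∣ (p₁ + 2).minFac := by obtain ⟨k, hk⟩ := hp₁odd; exact ⟨k + 1, by omega⟩
      rcases hq.eq_one_or_self_of_dvd 2 h2 with h' | h' <;> omega
    exact Nat.prime_def_minFac.mpr ⟨by omega, by omega⟩
  haveI : Fact (p₁ + 2).Prime := ⟨hp₀⟩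
  haveI : Fact p₁.Prime := ⟨hp₁⟩
  haveI : NeZero (p₁ + 2) := ⟨hp₀.ne_zero⟩
  obtain ⟨n'', rfl⟩ := hp₀n
  have hn''0 : n'' ≠ 0 := fun h0 ↦ hn0 (by rw [h0, mul_zero])
  haveI : NeZero n'' := ⟨hn''0⟩
  have hp₀n'' : ¬ p₁ + 2 ∣ n'' := fun hd ↦
    hsq₂ ((mul_dvd_mul_left (p₁ + 2) hd).trans ((dvd_mul_left ((p₁ + 2) * n'') p₁).trans hMm))
  have hp₁n'' : ¬ p₁ ∣ n'' := fun hd ↦ hpn (hd.trans (dvd_mul_left n'' (p₁ + 2)))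
  have hc₀ : Nat.Coprime (p₁ + 2) n'' := (Nat.Prime.coprime_iff_not_dvd hp₀).mpr hp₀n''
  have hc₂ : Nat.Coprime (p₁ * (p₁ + 2)) n'' :=
    Nat.Coprime.mul_left ((Nat.Prime.coprime_iff_not_dvd hp₁).mpr hp₁n'') hc₀
  have hn5'' : ∀ p' ∈ n''.primeFactors, 5 ≤ p' := fun p' hp' ↦ hM5 p' (by
    rw [Nat.primeFactors_mul hp₁.ne_zero hn0, Nat.primeFactors_mul hp₀.ne_zero hn''0]
    exact mem_union_right _ (mem_union_right _ hp'))
  have hroom'' : ∀ p' ∈ n''.primeFactors,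
      #(univ.filter fun u : ZMod (p₁ * ((p₁ + 2) * n'')) ↦ T u ≠ 0) + 1 < p' := by
    intro p' hp'
    have hp'P := Nat.prime_of_mem_primeFactors hp'
    have hp'n := Nat.dvd_of_mem_primeFactors hp'
    have hge := hMmin p' (by
      rw [Nat.primeFactors_mul hp₁.ne_zero hn0, Nat.primeFactors_mul hp₀.ne_zero hn''0]
      exact mem_union_right _ (mem_union_right _ hp'))
    have hne0 : p' ≠ p₁ := fun he ↦ hp₁n'' (he ▸ hp'n)
    have hne2 : p' ≠ p₁ + 2 := fun he ↦ hp₀n'' (he ▸ hp'n)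
    have h2' : ∀ k, p' = p₁ + 2 * k + 1 → False := by
      intro k he
      have h2 : 2 ∣ p' := by obtain ⟨k', hk'⟩ := hp₁odd; exact ⟨k' + k + 1, by omega⟩
      rcases hp'P.eq_one_or_self_of_dvd 2 h2 with h' | h' <;> omega
    have hne1 : p' ≠ p₁ + 1 := fun he ↦ h2' 0 (by omega)
    have hne3 : p' ≠ p₁ + 3 := fun he ↦ h2' 1 (by omega)
    rw [hSR]; omega
  have hN : p₁ * ((p₁ + 2) * n'') = p₁ * (p₁ + 2) * n'' := by ring
  have hpN : p₁ ∣ p₁ * ((p₁ + 2) * n'') := dvd_mul_right _ _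
  have hrN : p₁ + 2 ∣ p₁ * ((p₁ + 2) * n'') := ⟨p₁ * n'', by ring⟩
  have hnN : n'' ∣ p₁ * ((p₁ + 2) * n'') := ⟨p₁ * (p₁ + 2), by ring⟩
  -- reductions of `crt⁻¹` points through the tower `ℤ/(p₁ (p₀ n'')) → ℤ/(p₀ n'') → ℤ/p₀, ℤ/n''`
  have hcast_r : ∀ z : ZMod (p₁ * ((p₁ + 2) * n'')), ZMod.castHom hrN (ZMod (p₁ + 2)) z =
      ZMod.castHom (dvd_mul_right (p₁ + 2) n'') (ZMod (p₁ + 2))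
        (ZMod.castHom (dvd_mul_left ((p₁ + 2) * n'') p₁) (ZMod ((p₁ + 2) * n'')) z) := fun z ↦ by
    rw [← RingHom.comp_apply, ZMod.castHom_comp]
  have hcast_n : ∀ z : ZMod (p₁ * ((p₁ + 2) * n'')), ZMod.castHom hnN (ZMod n'') z =
      ZMod.castHom (dvd_mul_left n'' (p₁ + 2)) (ZMod n'')
        (ZMod.castHom (dvd_mul_left ((p₁ + 2) * n'') p₁) (ZMod ((p₁ + 2) * n'')) z) := fun z ↦ by
    rw [← RingHom.comp_apply, ZMod.castHom_comp]
  have hpt : ∀ (a : ZMod p₁) (y : ZMod (p₁ + 2)) (b'' : ZMod n''),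
      ZMod.castHom hpN (ZMod p₁) ((ZMod.chineseRemainder hc).symm
          (a, (ZMod.chineseRemainder hc₀).symm (y, b''))) = a ∧
      ZMod.castHom hrN (ZMod (p₁ + 2)) ((ZMod.chineseRemainder hc).symm
          (a, (ZMod.chineseRemainder hc₀).symm (y, b''))) = y ∧
      ZMod.castHom hnN (ZMod n'') ((ZMod.chineseRemainder hc).symm
          (a, (ZMod.chineseRemainder hc₀).symm (y, b''))) = b'' := by
    intro a y b''
    refine ⟨(castHom_crt_symm hc a _).1, ?_, ?_⟩
    · rw [hcast_r, (castHom_crt_symm hc a _).2, (castHom_crt_symm hc₀ y b'').1]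
    · rw [hcast_n, (castHom_crt_symm hc a _).2, (castHom_crt_symm hc₀ y b'').2]
  have hptu : ∀ (a : ZMod p₁) (y : ZMod (p₁ + 2)) (b'' : ZMod n''), IsUnit a → IsUnit y → IsUnit b'' →
      IsUnit ((ZMod.chineseRemainder hc).symm (a, (ZMod.chineseRemainder hc₀).symm (y, b''))) :=
    fun a y b'' ha hy hb ↦ (isUnit_crt_symm_iff hc _ _).mpr ⟨ha, (isUnit_crt_symm_iff hc₀ _ _).mpr ⟨hy, hb⟩⟩
  rcases Summit.HodgeConjecture.HodgeConjecture.Theorems.CancelByAnyClaimLattice.GenTwin.even_or_fibre_twin_any hN hpN hrN hnN hp₁11 hn5'' hc₂ T h01 hTu hTodd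
      hroom'' (by omega) with hev | ⟨b'', hb''u, u₀, hrow⟩ | ⟨b'', hb''u, y₀, hcol⟩
  · exact absurd hev hnotev
  · /- ROW: all `R` level-`M` unit parts are `≡ u₀ (mod p₁)` — contradicts `∑ αᵢ = 0` -/
    exfalso
    set f : (ZMod (p₁ + 2))ˣ → ZMod (p₁ * ((p₁ + 2) * n'')) := fun y ↦
      (ZMod.chineseRemainder hc).symm ((u₀ : ZMod p₁),
        (ZMod.chineseRemainder hc₀).symm ((y : ZMod (p₁ + 2)), b'')) with hf
    have hfinj : Function.Injective f := by
      intro y y' hyy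
      have h1 := congrArg (ZMod.chineseRemainder hc) hyy
      simp only [hf, RingEquiv.apply_symm_apply, Prod.mk.injEq, true_and] at h1
      have h2 := congrArg (ZMod.chineseRemainder hc₀) h1
      simp only [RingEquiv.apply_symm_apply, Prod.mk.injEq] at h2
      exact Units.ext h2.1
    have hsupp_eq : (univ.filter fun u : ZMod (p₁ * ((p₁ + 2) * n'')) ↦ T u ≠ 0) =
        (univ : Finset (ZMod (p₁ + 2))ˣ).image f := by
      symm
      apply Finset.eq_of_subset_of_card_le
      · intro u hu
        obtain ⟨y, -, rfl⟩ := mem_image.mp hu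
        rw [mem_filter]
        exact ⟨mem_univ _, hrow _ (hptu _ _ _ u₀.isUnit y.isUnit hb''u) (hpt _ _ _).1 (hpt _ _ _).2.2⟩
      · rw [hSR, Finset.card_image_of_injective _ hfinj, Finset.card_univ, ZMod.card_units_eq_totient,
          Nat.totient_prime hp₀]
        omega
    refine Summit.HodgeConjecture.HodgeConjecture.Theorems.CancelByAnyClaimLattice.GenTwin.false_of_row hp₁ hpN hMm hRp h.1.2 (fun i ↦ (hres i).1) u₀ fun i ↦ ?_
    have hmem := (hres i).2
    rw [hsupp_eq] at hmem
    obtain ⟨y, -, hy⟩ := mem_image.mp hmem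
    rw [← hy]
    exact (hpt _ _ _).1
  · /- COLUMN: a full `p₁`-fibre over `(y₀, b'')` — the conclusion -/
    refine ⟨(p₁ + 2) * n'', hc, rfl, ?_,
      (ZMod.chineseRemainder hc₀).symm ((y₀ : ZMod (p₁ + 2)), b''),
      (isUnit_crt_symm_iff hc₀ _ _).mpr ⟨y₀.isUnit, hb''u⟩, fun y ↦ ?_⟩
    · have := Nat.pos_of_ne_zero hn''0; nlinarith
    have hz : T ((ZMod.chineseRemainder hc).symm ((y : ZMod p₁),
        (ZMod.chineseRemainder hc₀).symm ((y₀ : ZMod (p₁ + 2)), b''))) ≠ 0 :=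
      hcol _ (hptu _ _ _ y.isUnit y₀.isUnit hb''u) (hpt _ _ _).2.1 (hpt _ _ _).2.2
    have hne0 : cnt ((ZMod.chineseRemainder hc).symm ((y : ZMod p₁),
        (ZMod.chineseRemainder hc₀).symm ((y₀ : ZMod (p₁ + 2)), b''))) ≠ 0 := by
      simpa only [hT, Nat.cast_ne_zero] using hz
    rw [hcnt] at hne0
    dsimp only at hne0
    obtain ⟨i, hi⟩ := Finset.card_ne_zero.mp hne0
    rw [mem_filter] at hi
    exact ⟨i, hi.2.1, hi.2.2⟩


end TopLevelGeneralTwinKey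

end PairedNull

end Summit.HodgeConjecture.HodgeConjecture.Theorems.CancelByAnyClaimLattice

end
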